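import Summits.AtomisticToContinuum.BoseEinsteinCondensation.Theorems.PeriodicToDirichlet.Negative.RewardedFreeGasAnchors
import Literature.MathematicalPhysics.QuantumManyBody.BoseGasDirichletWall

/-!
# Negative lemmas for crux `PeriodicToDirichlet` (stmt-AtomisticToContinuum-9483), rewarded free gas V:
the rewarded upper bound — free at `v = 0` for `c ≤ 1`, impossible for `c > 1`

Supports (does not close) stmt-AtomisticToContinuum-9483 (crux `PeriodicToDirichlet`, route
`BECThomsonPrinciple`), line `reward-pays-the-wall`: the target of stub 2
(`RewardedUpperBoundOfTorusBEC : … → TorusBECAt v ρ c → RewardedUpperBound v ρ c`, guard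
`c ≤ 1`) and the hypothesis of stub 3 (`RewardSandwich`). Filed by the crux disprover (gen 3);
imports part IV (`RewardedFreeGasAnchors`).

* `RewardedUpperBound` — COPY of the lead's stub vocabulary (deliberately untagged);
* `e0_zero` — `e₀(ρ) = 0` for the free gas (`E₀^D(0,N,L_N)/N ≤ 𝓔₀[β]/L_N² → 0`);
* `rewardedUpperBound_zero_of_le_one` — **at `v = 0`, `RewardedUpperBound 0 ρ c` holds for EVERY
  `c ≤ 1` and EVERY `ρ > 0`** (plateau states of part IV: `F^D(λ) ≤ N𝓔₀[u_η]/L² + λN(1 − (1−4η)⁶)`),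
  so the hypothesis of stub 3 is satisfiable non-vacuously and the whole chain stub 2 → 3 → 4 is
  consistent at `v = 0` (`RewardedUpperBound 0 ρ 1`, then `RewardedBoxBECAt 0 ρ λ c` for all
  `c < 1` by part IV, then flat-mode BEC at `λ = 0` only with a constant `< flatCap`, part II);
* `not_rewardedUpperBound_of_one_lt` — **TIGHTNESS of stub 2's guard**: `RewardedUpperBound v ρ c`
  is FALSE for every `c > 1`, every measurable `v` and every `ρ > 0` (take `θ = (c−1)/2` and `λ`
  large: the right side is `ofReal` of a negative number, i.e. `0`, under the Dirichlet wall
  `π²/(8L²) ≤ E₀^D ≤ F^D(λ)`). So `c ≤ 1` is not decoration for the CONCLUSION of stub 2 (drefute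
  noted it is logically idle for the implication since `TorusBECAt v ρ c` fails for `c > 1`).
-/

noncomputable section

open MeasureTheory Filter Set Metric
open scoped ENNReal NNReal ComplexConjugate Topology

namespace Summit.AtomisticToContinuum.BoseEinsteinCondensation.Theorems.PeriodicToDirichlet.Negative

open Literature.MathematicalPhysics.QuantumManyBody.BoseGas

/-- COPY of `RewardPaysTheWall.RewardedUpperBound` (target of stub 2, hypothesis of stub 3; a
statement of the line's proof plan, deliberately untagged): for every `θ > 0` and `λ ≥ 0`,
eventually `F^D(λ; N, L_N(ρ)) ≤ N (e₀(ρ) + θ + λ (1 − c + θ))`. -/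
def RewardedUpperBound (v : ℝ → ℝ≥0∞) (ρ c : ℝ) : Prop :=
  ∀ θ : ℝ, 0 < θ → ∀ lam : ℝ, 0 ≤ lam → ∀ᶠ N : ℕ in atTop,
    rewardedInf v lam N (sideLength ρ N) ≤
      ENNReal.ofReal ((N : ℝ) * ((e0 v ρ).toReal + θ + lam * (1 - c + θ)))

/-- **`e₀(ρ) = 0` for the free gas**: `E₀^D(0, N, L_N)/N ≤ 𝓔₀[β]/L_N² → 0`
(`groundStateEnergy_zero_le`, `tendsto_sideLength_atTop`), so the `limUnder` defining `e0` is `0`.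
[folklore] -/
theorem e0_zero {ρ : ℝ} (hρ : 0 < ρ) : e0 0 ρ = 0 := by
  have hK : energy 0 unitBump ≠ ⊤ := energy_unitBump_lt_top.ne
  have hup : ∀ᶠ N : ℕ in atTop, energyPerParticleDirichlet 0 ρ N ≤
      ENNReal.ofReal ((sideLength ρ N) ^ 2)⁻¹ * energy 0 unitBump := by
    filter_upwards [eventually_gt_atTop 0] with N hN
    have hL : 0 < sideLength ρ N := sideLength_pos_of_pos hρ hN
    unfold energyPerParticleDirichlet
    refine ENNReal.div_le_of_le_mul ?_
    calc groundStateEnergy 0 N (sideLength ρ N)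
        ≤ ENNReal.ofReal ((sideLength ρ N) ^ 2)⁻¹ * (N * energy 0 unitBump) :=
          groundStateEnergy_zero_le hL N
      _ = ENNReal.ofReal ((sideLength ρ N) ^ 2)⁻¹ * energy 0 unitBump * N := by ring
  have hlim : Tendsto (fun N : ℕ => ENNReal.ofReal ((sideLength ρ N) ^ 2)⁻¹ * energy 0 unitBump)
      atTop (𝓝 0) := by
    have h0 : Tendsto (fun N : ℕ => (sideLength ρ N) ^ 2) atTop atTop :=
      (tendsto_pow_atTop two_ne_zero).comp (tendsto_sideLength_atTop hρ)
    have h2 : Tendsto (fun N : ℕ => ENNReal.ofReal ((sideLength ρ N) ^ 2)⁻¹) atTop (𝓝 0) := by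
      simpa using ENNReal.tendsto_ofReal h0.inv_tendsto_atTop
    simpa using ENNReal.Tendsto.mul_const h2 (Or.inr hK)
  have hzero : Tendsto (energyPerParticleDirichlet 0 ρ) atTop (𝓝 0) :=
    tendsto_of_tendsto_of_tendsto_of_le_of_le' tendsto_const_nhds hlim
      (Eventually.of_forall fun _ => bot_le) hup
  exact hzero.limUnder_eq

/-- **At `v = 0` the rewarded upper bound holds for every `c ≤ 1`** (plateau trial states: with
`1 − (1−4η)⁶ ≤ θ` and `𝓔₀[u_η]/L_N² ≤ θ`, `F^D(λ) ≤ R_λ(u_η^{⊗N}) ≤ N(θ + λθ) ≤ N(θ + λ(1−c+θ))`).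
[folklore] -/
theorem rewardedUpperBound_zero_of_le_one {ρ c : ℝ} (hρ : 0 < ρ) (hc : c ≤ 1) :
    RewardedUpperBound 0 ρ c := by
  intro θ hθ lam hlam
  -- the plateau parameter: `1 − (1 − 4η)⁶ ≤ θ' := min θ 1`
  set θ' : ℝ := min θ 1 with hθ'
  have hθ'0 : 0 < θ' := lt_min hθ one_pos
  have hθ'1 : θ' ≤ 1 := min_le_right _ _
  have hθ'θ : θ' ≤ θ := min_le_left _ _
  set η : ℝ := θ' / 48 with hηdef
  have hη : 0 < η := by rw [hηdef]; positivity
  have hη4 : η < 1 / 4 := by rw [hηdef]; linarith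
  have hbern : 1 - θ' ≤ (1 - 4 * η) ^ 6 := by
    have h := one_add_mul_le_pow (show (-2 : ℝ) ≤ -(4 * η) by linarith) 6
    have : (1 : ℝ) + (6 : ℕ) * -(4 * η) = 1 - θ' / 2 := by rw [hηdef]; push_cast; ring
    rw [this] at h
    have h2 : (1 : ℝ) - θ' ≤ 1 - θ' / 2 := by linarith
    exact h2.trans (by simpa [sub_eq_add_neg] using h)
  -- the one-body energy of the plateau mode
  set K : ℝ≥0∞ := rawEnergy 0 (oneFun (plateauMode hη hη4)) with hK
  have hKtop : K ≠ ⊤ := rawEnergy_plateauMode_ne_top hη hη4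
  set Kr : ℝ := K.toReal with hKr
  have hKeq : K = ENNReal.ofReal Kr := (ENNReal.ofReal_toReal hKtop).symm
  have hKr0 : 0 ≤ Kr := ENNReal.toReal_nonneg
  -- large `N`: `Kr / L² ≤ θ'`
  set M : ℝ := max 1 (Kr / θ' + 1) with hM
  filter_upwards [(tendsto_sideLength_atTop hρ).eventually_ge_atTop M, eventually_gt_atTop 0]
    with N hNM hN
  obtain ⟨n, rfl⟩ : ∃ n, N = n + 1 := ⟨N - 1, by omega⟩
  set L := sideLength ρ (n + 1) with hL
  have hL0 : 0 < L := sideLength_pos_of_pos hρ hN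
  have hL1 : 1 ≤ L := (le_max_left _ _).trans hNM
  have hLK : Kr / L ^ 2 ≤ θ' := by
    have h2 : Kr / θ' + 1 ≤ L := (le_max_right _ _).trans hNM
    have h3 : L ≤ L ^ 2 := by nlinarith
    have h4 : Kr / θ' ≤ L ^ 2 := by linarith
    rw [div_le_iff₀ hθ'0] at h4
    rw [div_le_iff₀ (by positivity)]
    linarith
  have hNpos : (0 : ℝ) < n + 1 := by positivity
  set Φ := plateauBox hη hη4 (n + 1) hL0 with hΦ
  have hcast : ((n + 1 : ℕ) : ℝ≥0∞) = ENNReal.ofReal (n + 1) := by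
    rw [← Nat.cast_succ (R := ℝ), ENNReal.ofReal_natCast]
  -- energy of the plateau state
  have hEΦ : energy 0 Φ ≤ ENNReal.ofReal ((n + 1) * θ') := by
    rw [hΦ, energy_plateauBox, ← hK, hKeq, hcast, ← ENNReal.ofReal_mul (by positivity),
      ENNReal.ofReal_inv_of_pos (by positivity), ← ENNReal.div_eq_inv_mul,
      ← ENNReal.ofReal_div_of_pos (by positivity)]
    refine ENNReal.ofReal_le_ofReal ?_
    rw [div_le_iff₀ (by positivity)]
    rw [div_le_iff₀ (by positivity)] at hLK
    nlinarith
  -- reward part of the plateau state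
  have hoccΦ : ENNReal.ofReal ((n + 1) * (1 - θ')) ≤ occupation (n + 1) (flatMode L) Φ.ψ := by
    refine le_trans (ENNReal.ofReal_le_ofReal ?_) (occupation_plateauBox_ge hη hη4 n hL0)
    exact mul_le_mul_of_nonneg_left hbern hNpos.le
  have hsub : ((n + 1 : ℕ) : ℝ≥0∞) - occupation (n + 1) (flatMode L) Φ.ψ ≤
      ENNReal.ofReal ((n + 1) * θ') := by
    calc ((n + 1 : ℕ) : ℝ≥0∞) - occupation (n + 1) (flatMode L) Φ.ψ
        ≤ ENNReal.ofReal (n + 1) - ENNReal.ofReal ((n + 1) * (1 - θ')) := by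
          rw [hcast]; exact tsub_le_tsub_left hoccΦ _
      _ = ENNReal.ofReal ((n + 1) * θ') := by
          rw [← ENNReal.ofReal_sub _ (by nlinarith)]
          congr 1; ring
  -- assemble
  calc rewardedInf 0 lam (n + 1) L ≤ rewardedEnergy 0 lam Φ := iInf_le _ Φ
    _ ≤ ENNReal.ofReal ((n + 1) * θ') + ENNReal.ofReal lam * ENNReal.ofReal ((n + 1) * θ') := by
        unfold rewardedEnergy
        gcongr
    _ = ENNReal.ofReal ((n + 1) * θ' + lam * ((n + 1) * θ')) := by
        rw [← ENNReal.ofReal_mul hlam, ← ENNReal.ofReal_add (by positivity) (by positivity)]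
    _ ≤ ENNReal.ofReal (((n + 1 : ℕ) : ℝ) * ((e0 0 ρ).toReal + θ + lam * (1 - c + θ))) := by
        refine ENNReal.ofReal_le_ofReal ?_
        rw [e0_zero hρ, ENNReal.toReal_zero, zero_add]
        push_cast
        have h1 : lam * ((n + 1) * θ') ≤ (n + 1) * (lam * (1 - c + θ)) := by
          have : θ' ≤ 1 - c + θ := by linarith
          nlinarith [mul_nonneg hlam hNpos.le]
        nlinarith

/-- **TIGHTNESS of stub 2's guard `c ≤ 1`**: `RewardedUpperBound v ρ c` is FALSE for every
`c > 1` (any measurable `v`, any `ρ > 0`): with `θ = (c−1)/2` the coefficient `1 − c + θ < 0`, so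
for `λ` large the right side is `ofReal` of a negative number, i.e. `0`, while
`F^D(λ) ≥ E₀^D ≥ π²/(8L²) > 0` (the Dirichlet wall). [folklore] -/
theorem not_rewardedUpperBound_of_one_lt {v : ℝ → ℝ≥0∞} (hv : Measurable v) {ρ c : ℝ}
    (hρ : 0 < ρ) (hc : 1 < c) : ¬ RewardedUpperBound v ρ c := by
  intro h
  set E : ℝ := (e0 v ρ).toReal with hE
  have hE0 : 0 ≤ E := ENNReal.toReal_nonneg
  set θ : ℝ := (c - 1) / 2 with hθ
  have hθ0 : 0 < θ := by rw [hθ]; linarith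
  set lam : ℝ := 2 * (E + θ) / (c - 1) + 1 with hlam
  have hlam0 : 0 ≤ lam := by rw [hlam]; positivity
  have hneg : E + θ + lam * (1 - c + θ) < 0 := by
    have hcoef : 1 - c + θ = -((c - 1) / 2) := by rw [hθ]; ring
    rw [hcoef, hlam]
    have hc1 : 0 < c - 1 := by linarith
    have : (2 * (E + θ) / (c - 1) + 1) * ((c - 1) / 2) = (E + θ) + (c - 1) / 2 := by
      field_simp
    nlinarith
  obtain ⟨N, hN, hle⟩ := ((eventually_gt_atTop 0).and (h θ hθ0 lam hlam0)).exists
  have hL : 0 < sideLength ρ N := sideLength_pos_of_pos hρ hN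
  have hrhs : ENNReal.ofReal ((N : ℝ) * (E + θ + lam * (1 - c + θ))) = 0 :=
    ENNReal.ofReal_of_nonpos (mul_nonpos_of_nonneg_of_nonpos N.cast_nonneg hneg.le)
  rw [← hE, hrhs, nonpos_iff_eq_zero] at hle
  have hwall := dirichlet_wall hv hL (Nat.one_le_of_lt hN)
  have hmono : groundStateEnergy v N (sideLength ρ N) ≤ rewardedInf v lam N (sideLength ρ N) :=
    le_iInf fun Ψ => (groundStateEnergy_le_energy v Ψ).trans le_self_add
  rw [hle, nonpos_iff_eq_zero] at hmono
  rw [hmono] at hwall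
  have : (0 : ℝ≥0∞) < ENNReal.ofReal (Real.pi ^ 2 / (8 * sideLength ρ N ^ 2)) := by
    rw [ENNReal.ofReal_pos]; positivity
  exact absurd hwall (not_le.2 this)

/-- **The chain of stubs 2 → 3 → 4 is consistent at `v = 0`, with the constant dropping only at
the last step**: `RewardedUpperBound 0 ρ 1`; rewarded anchors `RewardedBoxBECAt 0 ρ λ c` for all
`c < 1`, `λ > 0` (part IV); at `λ = 0` no flat-mode BEC with constant `flatCap` (part II).
[folklore] -/
theorem freeGas_chain {ρ : ℝ} (hρ : 0 < ρ) :
    RewardedUpperBound 0 ρ 1 ∧ (∀ c lam : ℝ, c < 1 → 0 < lam → RewardedBoxBECAt 0 ρ lam c) ∧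
      ¬ RewardedBoxBECAt 0 ρ 0 flatCap :=
  ⟨rewardedUpperBound_zero_of_le_one hρ le_rfl,
    fun _ _ hc hlam => rewardedBoxBECAt_zero_of_lt_one hρ hc hlam,
    not_rewardedBoxBECAt_zero_flatCap hρ⟩

end Summit.AtomisticToContinuum.BoseEinsteinCondensation.Theorems.PeriodicToDirichlet.Negative

end
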